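import Literature.NumberTheory.EllipticCurves.IsogenyTwoPowerQuotientProofs
import HarnessLib

/-!
# Crux `MazurKenkuBound` (stmt-ABC-15125), line `Sketch` — stub `stub_twoVertex`:
# the vertex criterion of the `2`-chain

On an elliptic curve `V : y² = x³ + ax² + bx` over `ℚ` (two-torsion normal form, `T = (0, 0)`
its rational `2`-torsion point), a `Γ_ℚ`-stable cyclic subgroup `C ⊆ V(ℚ̄)` of order `2ᵏ`,
`k ≥ 2`, whose element of order `2` is `T` forces `b` to be a square in `ℚ`:

1. a generator `g` of `C` has order `2ᵏ`, so `Q := 2ᵏ⁻² g ∈ C` has `2Q ≠ O`, `4Q = O`,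
   whence `2Q = T` (the hypothesis on the `2`-torsion of `C`); `Q ∉ {O, T}`, so `Q = (x, y)` with
   `x ≠ 0`, `y ≠ -y`, and the duplication formula `x(2Q) · (2y)² = (x² - b)²` (Silverman,
   *AEC*, III.2.3 (d); the tree's `addX_self_mul`) with `x(2Q) = x(T) = 0` gives `x² = b`;
2. for `σ ∈ Γ_ℚ`, `σT = T` and `σQ ∈ C` with `2(σQ - Q) = O`, so `σQ - Q ∈ {O, T}`:
   `σQ = Q` or `σQ = T + Q = (b/x, -by/x²) = (x, -y)`; in both cases `σx = x(σQ) = x`;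
3. `ℚ̄^{Γ_ℚ} = ℚ` (Mathlib's `InfiniteGalois.mem_range_algebraMap_iff_fixed`, `ℚ` perfect),
   so `x = d ∈ ℚ` and `b = d²`.

The argument is written for any perfect base field (`twoVertex_exists_sq`) and specialised to
the literal equation `⟨0, a, 0, b, 0⟩` over `ℚ` in `stub_twoVertex`.

## References

* [SilvermanAEC2009] J. H. Silverman, *The Arithmetic of Elliptic Curves*, 2nd ed., GTM 106
  (2009), III.2.3 (d) (duplication formula), III.4 Example 4.5, X.4.9; I.§1 and VIII.§1
  (Galois descent).
-/

-- `Summit.ABC.ABC` is the mandated summit-side namespace (CONVENTIONS §2); the duplicate is deliberate.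
set_option linter.dupNamespace false

noncomputable section

open scoped Classical
open WeierstrassCurve
open Literature.NumberTheory.EllipticCurves

namespace Summit.ABC.ABC.Theorems

universe u

/-- On `y² = x³ + ax² + bx` (two-torsion normal form, elliptic), an affine point `P` with
`P + P = T = (0, 0)` is `(x, y)` with `x ≠ 0` and `x² = b`: `P ∉ {O, T}` and `y ≠ -y`, and
the duplication formula `x(2P) · (2y)² = (x² - b)²` with `x(2P) = 0`.
[cite: SilvermanAEC2009, III.2.3 (d)] -/
private theorem exists_eq_some_sq_eq_of_add_self_eq {F : Type*} [Field F]
    (W : WeierstrassCurve F) [W.IsTwoTorsionNF] [W.IsElliptic] {P : W.toAffine.Point}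
    (hP : P + P = W.twoTorsionPoint) :
    ∃ (x y : F) (h : W.toAffine.Nonsingular x y),
      P = .some x y h ∧ x ≠ 0 ∧ x ^ 2 = W.a₄ := by
  rcases P with _ | ⟨x, y, h⟩
  · rw [← Affine.Point.zero_def, add_zero] at hP
    exact absurd hP.symm (Affine.Point.some_ne_zero _)
  · have hy : y ≠ W.toAffine.negY x y := by
      intro hy
      rw [Affine.Point.add_self_of_Y_eq hy] at hP
      exact Affine.Point.some_ne_zero _ hP.symm
    have key := addX_self_mul W h hy
    rw [Affine.Point.add_self_of_Y_ne hy, twoTorsionPoint, Affine.Point.some.injEq] at hP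
    rw [hP.1, zero_mul] at key
    have hxb : x ^ 2 = W.a₄ := sub_eq_zero.mp ((pow_eq_zero_iff two_ne_zero).mp key.symm)
    refine ⟨x, y, h, rfl, ?_, hxb⟩
    rintro rfl
    apply a₄_ne_zero W
    rw [← hxb]
    ring

/-- `T + (x, y) = (b/x, -by/x²)` has first coordinate `x` when `x² = b`. [folklore] -/
private theorem exists_twoTorsionPoint_add_some_eq {F : Type*} [Field F]
    (W : WeierstrassCurve F) [W.IsTwoTorsionNF] [W.IsElliptic] {x y : F}
    (h : W.toAffine.Nonsingular x y) (hx : x ≠ 0) (hxb : x ^ 2 = W.a₄) :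
    ∃ (y' : F) (h' : W.toAffine.Nonsingular x y'),
      W.twoTorsionPoint + .some x y h = .some x y' h' := by
  obtain ⟨h', e⟩ := twoTorsionPoint_add_some W h hx
  have hX : W.a₄ / x = x := by rw [div_eq_iff hx, ← hxb, sq]
  obtain ⟨h'', e''⟩ := some_eq_some_of_eq h' hX rfl
  exact ⟨_, h'', e.trans e''⟩

/-- **The vertex criterion** (any perfect base field `K`): on an elliptic
`V : y² = x³ + ax² + bx` over `K`, a `Γ_K`-stable cyclic subgroup `C ⊆ V(K̄)` of order `2ᵏ`,
`k ≥ 2`, whose element of order `2` is `T = (0, 0)` forces `b = d²` with `d ∈ K`: the point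
`Q = 2ᵏ⁻²g` (`g` a generator)
has `2Q = T`, so `x(Q)² = b` (duplication formula), and `σQ - Q ∈ C ∩ V[2] = {O, T}` gives
`σQ ∈ {Q, T + Q}`, both with first coordinate `x(Q)`; hence `x(Q) ∈ K̄^{Γ_K} = K`.
[cite: SilvermanAEC2009, III.2.3 (d)] -/
theorem twoVertex_exists_sq {K : Type u} [Field K] [PerfectField K] (V : WeierstrassCurve K)
    [V.IsTwoTorsionNF] [V.IsElliptic] (C : AddSubgroup V.geomPoints) {k : ℕ} (hk : 2 ≤ k)
    (hst : ∀ σ : Field.absoluteGaloisGroup K, ∀ P ∈ C, σ • P ∈ C) (hcyc : IsAddCyclic C)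
    (hcard : Nat.card C = 2 ^ k)
    (h2 : ∀ P ∈ C, 2 • P = 0 → P ≠ 0 → P = V.geomTwoTorsionPoint) :
    ∃ d : K, V.a₄ = d ^ 2 := by
  -- a point `Q ∈ C` with `4Q = O`, `2Q ≠ O`
  obtain ⟨Q, hQC, h4Q, h2Q0⟩ : ∃ Q ∈ C, 2 • (2 • Q) = 0 ∧ 2 • Q ≠ 0 := by
    obtain ⟨g, hg⟩ := IsAddCyclic.exists_ofOrder_eq_natCard (α := C)
    rw [hcard, ← AddSubgroup.addOrderOf_coe] at hg
    refine ⟨2 ^ (k - 2) • (g : V.geomPoints), C.nsmul_mem g.2 _, ?_, ?_⟩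
    · have e : 2 * 2 * 2 ^ (k - 2) = 2 ^ k := by
        rw [mul_assoc, ← pow_succ', ← pow_succ', show k - 2 + 1 + 1 = k by omega]
      rw [smul_smul, smul_smul, e, ← hg]
      exact addOrderOf_nsmul_eq_zero _
    · intro h0
      rw [smul_smul, ← pow_succ'] at h0
      have hdvd := addOrderOf_dvd_of_nsmul_eq_zero h0
      rw [hg, Nat.pow_dvd_pow_iff_le_right Nat.one_lt_two] at hdvd
      omega
  -- `2Q = T ∈ C`
  have hT : 2 • Q = V.geomTwoTorsionPoint := h2 _ (C.nsmul_mem hQC 2) h4Q h2Q0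
  have hTC : V.geomTwoTorsionPoint ∈ C := hT ▸ C.nsmul_mem hQC 2
  -- coordinates of `Q`: `x ≠ 0`, `x² = b`
  obtain ⟨x, y, h, hQ, hx, hxb⟩ := exists_eq_some_sq_eq_of_add_self_eq
    (V.baseChange (AlgebraicClosure K)) (P := Q) (by rw [← two_nsmul]; exact hT)
  obtain ⟨y', h', e'⟩ :=
    exists_twoTorsionPoint_add_some_eq (V.baseChange (AlgebraicClosure K)) h hx hxb
  have hTQ : V.geomTwoTorsionPoint + Q = (Affine.Point.some x y' h' : V.geomPoints) := by
    rw [hQ]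
    exact e'
  -- `x` is fixed by `Γ_K`
  have hfix : ∀ σ : Field.absoluteGaloisGroup K,
      (show AlgebraicClosure K ≃ₐ[K] AlgebraicClosure K from σ) x = x := by
    intro σ
    -- `σT = T`
    have hσT : σ • V.geomTwoTorsionPoint = V.geomTwoTorsionPoint := by
      refine h2 _ (hst σ _ hTC) ?_ ?_
      · rw [smul_comm, ← hT, h4Q, smul_zero]
      · exact (smul_ne_zero_iff_ne σ).mpr (geomTwoTorsionPoint_ne_zero V)
    -- `2(σQ - Q) = O`, so `σQ - Q ∈ {O, T}`
    have hD : 2 • (σ • Q - Q) = 0 := by rw [nsmul_sub, smul_comm, hT, hσT, sub_self]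
    obtain ⟨h₁, e₁⟩ := smul_eq_some_of_eq' V σ hQ
    by_cases hD0 : σ • Q - Q = 0
    · rw [sub_eq_zero, e₁, hQ] at hD0
      exact (Affine.Point.some.inj hD0).1
    · have hDT := h2 _ (C.sub_mem (hst σ Q hQC) hQC) hD hD0
      rw [sub_eq_iff_eq_add, e₁, hTQ] at hDT
      exact (Affine.Point.some.inj hDT).1
  -- Galois descent: `x ∈ K`
  haveI : IsGalois K (AlgebraicClosure K) := {}
  obtain ⟨d, hd⟩ := (InfiniteGalois.mem_range_algebraMap_iff_fixed x).mpr fun σ ↦ hfix σ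
  refine ⟨d, (algebraMap K (AlgebraicClosure K)).injective ?_⟩
  rw [map_pow, hd, hxb]
  rfl

/-- STUB 9 (vertex criterion): on an elliptic `y² = x³ + ax² + bx` over `ℚ`, a `Γ_ℚ`-stable
cyclic subgroup of order `2ᵏ`, `k ≥ 2`, whose element of order `2` is `T = (0,0)` forces `b` to
be a square: a point `Q` of order `4` in it has `2Q = T`, so `x(Q)² = b` by the duplication
formula (`addX_self_mul`), and `σQ ∈ {Q, Q + T}` for all `σ ∈ Γ_ℚ`, so `x(Q) ∈ ℚ`
(`twoVertex_exists_sq` on the literal equation). [cite: SilvermanAEC2009, III.2.3 (d)] -/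
theorem stub_twoVertex :
    ∀ (a b : ℚ) [(⟨0, a, 0, b, 0⟩ : WeierstrassCurve ℚ).IsElliptic]
      (C : AddSubgroup (⟨0, a, 0, b, 0⟩ : WeierstrassCurve ℚ).geomPoints) (k : ℕ), 2 ≤ k →
      (∀ σ : Field.absoluteGaloisGroup ℚ, ∀ P ∈ C, σ • P ∈ C) → IsAddCyclic C →
      Nat.card C = 2 ^ k →
      (∀ P ∈ C, 2 • P = 0 → P ≠ 0 →
        P = (⟨0, a, 0, b, 0⟩ : WeierstrassCurve ℚ).geomTwoTorsionPoint) →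
      ∃ d : ℚ, b = d ^ 2 := by
  intro a b _ C k hk hst hcyc hcard h2
  exact twoVertex_exists_sq (⟨0, a, 0, b, 0⟩ : WeierstrassCurve ℚ) C hk hst hcyc hcard h2

end Summit.ABC.ABC.Theorems

end
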